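import Mathlib.NumberTheory.ArithmeticFunction.VonMangoldt
import Mathlib.NumberTheory.Harmonic.EulerMascheroni
import Mathlib.Analysis.PSeries
import Mathlib.Analysis.SpecialFunctions.Trigonometric.Deriv
import Literature.NumberTheory.LFunctions.RiemannXi
import Literature.NumberTheory.LFunctions.ZetaZeros
import Literature.Analysis.Complex.PositiveKernelContinuation
import HarnessLib

/-!
# Suzuki's screw function `Ψ` of the Riemann zeta-function

M. Suzuki, *Aspects of the screw function corresponding to the Riemann zeta-function*,
J. London Math. Soc. 108 (2023) = arXiv:2206.03682 (`Suzuki2023`), attaches to `ζ` the real,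
even, continuous function (Suzuki2023 (1.1), extended evenly to `ℝ` as on p. 2 of the paper)

`Ψ(t) = 4(e^{t/2} + e^{-t/2} - 2) - ∑_{n ≤ e^t} Λ(n) n^{-1/2} (t - log n)
        + (t/2) [ (Γ'/Γ)(1/4) - log π ] + (1/4) ( C - e^{-t/2} Φ(e^{-2t}, 2, 1/4) )`, `t ≥ 0`,

where `Λ` is the von Mangoldt function, `C = ζ(2, 1/4) = Φ(1, 2, 1/4) = ∑_{k ≥ 0} (k + 1/4)^{-2}`
(`= π² + 8G`, `G` Catalan's constant; Suzuki2023 §2.1) and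
`Φ(z, s, a) = ∑_{k ≥ 0} (k + a)^{-s} z^k` is the Hurwitz–Lerch zeta function, so that
`Φ(e^{-2t}, 2, 1/4) = ∑_{k ≥ 0} e^{-2tk} (k + 1/4)^{-2}`. With Gauss' value
`(Γ'/Γ)(1/4) = -γ₀ - π/2 - 3 log 2` (printed in the proof of Suzuki2023 Thm 4.1) the linear term is
`-(t/2)(γ₀ + π/2 + 3 log 2 + log π)`. The function `g := -Ψ` is "the screw function of the
Riemann zeta-function" (Suzuki2023 (1.8), Thm 1.2): RH holds iff `g` lies in Kreĭn's class `𝒢_∞`,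
i.e. iff the kernel `G_g(t, u) = g(t - u) - g(t) - g(-u) + g(0) = Ψ(t) + Ψ(u) - Ψ(t - u)`
(Suzuki2023 (1.4); `Ψ` is even with `Ψ(0) = 0`) is non-negative definite on `ℝ`.

## Contents

* `zetaScrew t = Ψ(t)` — the body is, token for token, the prime-side term inlined by the route
  theses `Summits/RiemannHypothesis/RiemannHypothesis/Theses/PluckedString.lean`
  (`let Ψ : ℝ → ℝ := fun t => …`), so that those items can be restated over the named notion by
  `rfl` (`zetaScrew_def`).
* `zetaScrewPrimeSum t = ∑_{n ≤ e^{|t|}} Λ(n) n^{-1/2} (|t| - log n)` (Suzuki's `φ(t)`,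
  Prop. 2.1) and `hurwitzLerchQuarter t = Φ(e^{-2|t|}, 2, 1/4)`; `zetaScrew_eq` splits `Ψ`
  into these parts.
* `zetaScrewKernel t u = Ψ(t) + Ψ(u) - Ψ(t - u)` — Suzuki's kernel `G_g` for `g = -Ψ`.
* API (all proved): `zetaScrew_neg` (even), `zetaScrew_zero` (`Ψ(0) = 0`),
  `zetaScrew_eq_of_abs_lt_log_two` (no prime contributes on the "wall" `|t| < log 2`),
  `continuous_zetaScrew`, symmetry/diagonal of the kernel, and the bridge
  `isPosSemidefKernelOn_zetaScrewKernel_iff` between Suzuki's complex form (1.5) — stated with the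
  tree's `Literature.Analysis.Complex.IsPosSemidefKernelOn` — and the real quadratic forms
  `∑ᵢⱼ K(tᵢ, tⱼ) xᵢ xⱼ ≥ 0` used by the route items (equivalent because the kernel is real and
  symmetric, `sum_sum_conj_mul_mul_ofReal`).
* NAMED FACTS (statements as printed, `def … : Prop`, users take `(h : …)`):
  `Suzuki2023_thm11_fourier` (Thm 1.1 (1), one-sided Fourier transform `= -z^{-2}(ξ'/ξ)(1/2 - iz)`),
  `Suzuki2023_thm11_series` (Thm 1.1 (2), `Ψ(t) = ∑_γ (1 - cos γt)/γ²`),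
  `Suzuki2023_thm11_growth` (Thm 1.1 (3), `Ψ(t) ≪ exp(t/2 - c√t)`),
  `Suzuki2023_thm12` (RH `↔` `-Ψ ∈ 𝒢_∞`), `Suzuki2023_thm17` (RH `↔` `Ψ ≥ 0`), `Suzuki2023_thm41` (`Ψ > 0` on `(0, t₀)`, `t₀ > log 2`),
  `Suzuki2023_thm42_screw` (unconditionally `-Ψ|_{(-2a,2a)} ∈ 𝒢_a` for small `a`).

## Dictionary zeros `γ` ↔ zeros `ρ`

Suzuki sums over the zeros `γ` of `ξ(1/2 - iz)` with multiplicity, `ξ` = Riemann's `ξ`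
(= `Literature.NumberTheory.LFunctions.riemannXi`, whose zeros are the non-trivial zeros of `ζ`
with the multiplicities `riemannZetaZeroOrder`). Under `ρ = 1/2 - iγ`, i.e. `γ = i(ρ - 1/2)`,
one has `γ² = -(ρ - 1/2)²` and `cos(γt) = cosh((ρ - 1/2)t)`, so
`(1 - cos γt)/γ² = (cosh((ρ - 1/2)t) - 1)/(ρ - 1/2)²`; `ρ ↦ γ` is a multiplicity-preserving
bijection from `ZetaZeros.riemannZetaNontrivialZeros` onto the zeros of `ξ(1/2 - iz)`. This is how
`Suzuki2023_thm11_series` is written.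

## Remarks on faithfulness

* The definition is (1.1) with `t` replaced by `|t|` ("we understand by replacing `t` with `-t`
  in the right-hand side of (1.1) when `t` is negative", Suzuki2023 p. 2); the sum over
  `n ≤ e^{|t|}` is `Finset.Icc 1 ⌊e^{|t|}⌋₊` (the term `n = 1` vanishes, `Λ(1) = 0`).
* Numerical check of the transcription (this file's term, evaluated in floating point):
  `Ψ(0) = 0`, `Ψ(0.464002) = 0.039661…` (Suzuki2023 proof of Thm 4.1: `Ψ(t₂) = 0.0396618…`),
  and `Ψ'` vanishes at `0.152631…`, `0.464002…` as printed there. (The closed form for `Ψ'` on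
  `[0, log 2)` printed in that proof, `c = π/4 - (γ₀ + 3 log 2)/2`, omits the `log π` of (1.1):
  differentiating (1.1) gives `c = π/4 - (γ₀ + 3 log 2 + log π)/2`, and only this value
  reproduces the printed zeros. Only the STATEMENT of Thm 4.1 is vendored here.)
* Thm 1.2 says "RH iff `g = -Ψ` is a screw function on `ℝ`", i.e. `g ∈ 𝒢_∞`: `g` continuous,
  `g(-t) = conj g(t)`, kernel (1.4) non-negative definite in the sense (1.5) (complex
  coefficients). For this `g` continuity and hermitian symmetry hold unconditionally
  (`continuous_zetaScrew`, `zetaScrew_neg`; `Ψ` is real), so membership in `𝒢_a` is exactly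
  `IsPosSemidefKernelOn (fun t u ↦ (zetaScrewKernel t u : ℂ)) (Ioo (-a) a)` (`a = ∞`: `univ`).

## Deliberately NOT here

* Prop. 3.1 (`⟨Dψ₁, Dψ₂⟩_{G_g,a} = W(ψ₁ ∗ ψ̃₂)`) and §3.4–3.5 (`Ψ(t) = W(Δ_t)`, `Ψ'' = W` as
  distributions): in the tree's normalisation (`weilFunctional`, `WeilExplicit.lean`) these are
  the route items `PsiWeilIdentity`/`ScrewToWeilOn` of route PluckedString and are left to provers.
* Thms 1.3–1.6, 1.8, Prop. 2.1 (hermitian forms on `𝔈₀(a)`, non-degeneracy, trace class,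
  `Ψ = O(1)`, Hankel moments, the twice-integrated prime number theorem behind Thm 1.1 (3)),
  §§8–12 (Li coefficients, Kotani's zeta string, mean-periodicity), and Kreĭn's classes `𝒢_a`
  for general `g` (definition request `KreinString`, `Literature/Analysis/InverseSpectral`).

## References

* M. Suzuki, *Aspects of the screw function corresponding to the Riemann zeta-function*,
  J. Lond. Math. Soc. (2) 108 (2023), no. 4, 1448–1487; arXiv:2206.03682. [Suzuki2023]
* M. G. Kreĭn, H. Langer, *Continuation of Hermitian positive definite functions and related
  questions*, Integral Equations Operator Theory 78 (2014) (screw functions, classes `𝒢_a`).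
-/

noncomputable section

open scoped Topology ComplexConjugate ComplexOrder BigOperators

open Literature.Analysis.Complex (IsPosSemidefKernelOn)

namespace Literature.NumberTheory.LFunctions

/-! ## The function `Ψ` -/

/-- **Suzuki's screw function of `ζ`** (more precisely `Ψ = -g`), Suzuki2023 (1.1) extended evenly
to `ℝ`:
`Ψ(t) = 4(e^{|t|/2} + e^{-|t|/2} - 2) - ∑_{1 ≤ n ≤ e^{|t|}} Λ(n) n^{-1/2} (|t| - log n)
  - (|t|/2)(γ₀ + π/2 + 3 log 2 + log π) + (1/4)(∑_{k ≥ 0} (k + 1/4)^{-2} - e^{-|t|/2} ∑_{k ≥ 0} e^{-2|t|k} (k + 1/4)^{-2})`,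
where `(Γ'/Γ)(1/4) - log π = -(γ₀ + π/2 + 3 log 2 + log π)` (Gauss), `C = ∑ (k + 1/4)^{-2} = ζ(2, 1/4)`
and the last series is `Φ(e^{-2|t|}, 2, 1/4)`. The body is verbatim the term inlined in the route
theses of `PluckedString` (see `zetaScrew_def`). It is even (`zetaScrew_neg`), vanishes at `0`
(`zetaScrew_zero`) and is continuous (`continuous_zetaScrew`). [cite: Suzuki2023, (1.1)] -/
def zetaScrew (t : ℝ) : ℝ :=
  4 * (Real.exp (|t| / 2) + Real.exp (-(|t| / 2)) - 2) - (∑ n ∈ Finset.Icc 1 ⌊Real.exp |t|⌋₊, ArithmeticFunction.vonMangoldt n / Real.sqrt n * (|t| - Real.log n)) - |t| / 2 * (Real.eulerMascheroniConstant + Real.pi / 2 + 3 * Real.log 2 + Real.log Real.pi) + (1 / 4) * ((∑' k : ℕ, 1 / ((k : ℝ) + 1 / 4) ^ 2) - Real.exp (-(|t| / 2)) * ∑' k : ℕ, Real.exp (-(2 * |t| * k)) / ((k : ℝ) + 1 / 4) ^ 2)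

/-- Unfolding lemma: `zetaScrew t` is, by `rfl`, the term inlined as `let Ψ : ℝ → ℝ := fun t => …`
in the route theses `StringThesis`, `PsiWeilIdentity`, `ScrewToWeilOn`, `ScrewConverse` of
`Summits/RiemannHypothesis/RiemannHypothesis/Theses/PluckedString.lean`. [cite: Suzuki2023, (1.1)] -/
theorem zetaScrew_def (t : ℝ) :
    zetaScrew t = 4 * (Real.exp (|t| / 2) + Real.exp (-(|t| / 2)) - 2) - (∑ n ∈ Finset.Icc 1 ⌊Real.exp |t|⌋₊, ArithmeticFunction.vonMangoldt n / Real.sqrt n * (|t| - Real.log n)) - |t| / 2 * (Real.eulerMascheroniConstant + Real.pi / 2 + 3 * Real.log 2 + Real.log Real.pi) + (1 / 4) * ((∑' k : ℕ, 1 / ((k : ℝ) + 1 / 4) ^ 2) - Real.exp (-(|t| / 2)) * ∑' k : ℕ, Real.exp (-(2 * |t| * k)) / ((k : ℝ) + 1 / 4) ^ 2) :=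
  rfl

/-- The prime sum `φ(t) = ∑_{n ≤ e^{t}} Λ(n) n^{-1/2} (t - log n)` of Suzuki2023 (1.1) / Prop. 2.1
(there denoted `φ`), extended evenly (`t ↦ |t|`). A finite sum over `1 ≤ n ≤ ⌊e^{|t|}⌋`. [cite: Suzuki2023, (1.1) and Prop. 2.1] -/
def zetaScrewPrimeSum (t : ℝ) : ℝ :=
  ∑ n ∈ Finset.Icc 1 ⌊Real.exp |t|⌋₊,
    ArithmeticFunction.vonMangoldt n / Real.sqrt n * (|t| - Real.log n)

/-- The Hurwitz–Lerch value `Φ(e^{-2|t|}, 2, 1/4) = ∑_{k ≥ 0} e^{-2|t|k} (k + 1/4)^{-2}` entering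
Suzuki2023 (1.1) (`Φ(z, s, a) = ∑_{k ≥ 0} (k + a)^{-s} z^k`); at `t = 0` it is
`C = ζ(2, 1/4) = π² + 8G` (`hurwitzLerchQuarter_zero`). The series converges for every real `t`
(`summable_hurwitzLerchQuarter`). [cite: Suzuki2023, (1.1) and §2.1] -/
def hurwitzLerchQuarter (t : ℝ) : ℝ :=
  ∑' k : ℕ, Real.exp (-(2 * |t| * k)) / ((k : ℝ) + 1 / 4) ^ 2

/-- `Ψ` split into its four parts: archimedean `4(e^{|t|/2} + e^{-|t|/2} - 2)`, prime sum, linear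
term, Hurwitz–Lerch term (definitional). [cite: Suzuki2023, (1.1)] -/
theorem zetaScrew_eq (t : ℝ) :
    zetaScrew t = 4 * (Real.exp (|t| / 2) + Real.exp (-(|t| / 2)) - 2) - zetaScrewPrimeSum t
      - |t| / 2 * (Real.eulerMascheroniConstant + Real.pi / 2 + 3 * Real.log 2 + Real.log Real.pi)
      + (1 / 4) * ((∑' k : ℕ, 1 / ((k : ℝ) + 1 / 4) ^ 2)
          - Real.exp (-(|t| / 2)) * hurwitzLerchQuarter t) :=
  rfl

/-- `Ψ` is even (it is (1.1) in the variable `|t|`; Suzuki2023 p. 2). [cite: Suzuki2023, p. 2 (even extension)] -/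
@[simp] theorem zetaScrew_neg (t : ℝ) : zetaScrew (-t) = zetaScrew t := by
  simp only [zetaScrew, abs_neg]

/-- `Ψ(|t|) = Ψ(t)`. [folklore] -/
@[simp] theorem zetaScrew_abs (t : ℝ) : zetaScrew |t| = zetaScrew t := by
  simp only [zetaScrew, abs_abs]

/-- The prime sum is even. [folklore] -/
@[simp] theorem zetaScrewPrimeSum_neg (t : ℝ) : zetaScrewPrimeSum (-t) = zetaScrewPrimeSum t := by
  simp only [zetaScrewPrimeSum, abs_neg]

/-- `Φ(e^{-2|t|}, 2, 1/4)` is even in `t`. [folklore] -/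
@[simp] theorem hurwitzLerchQuarter_neg (t : ℝ) :
    hurwitzLerchQuarter (-t) = hurwitzLerchQuarter t := by
  simp only [hurwitzLerchQuarter, abs_neg]

/-- At `t = 0` the Hurwitz–Lerch term is the constant `C = ∑_{k ≥ 0} (k + 1/4)^{-2} = ζ(2, 1/4)`
(Suzuki2023 §2.1: `C = ζ(2,1/4) = Φ(1,2,1/4)`). [cite: Suzuki2023, §2.1] -/
theorem hurwitzLerchQuarter_zero :
    hurwitzLerchQuarter 0 = ∑' k : ℕ, 1 / ((k : ℝ) + 1 / 4) ^ 2 := by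
  simp only [hurwitzLerchQuarter, abs_zero, mul_zero, zero_mul, neg_zero, Real.exp_zero]

/-- `φ(0) = 0`: at `t = 0` only `n = 1` is summed and `Λ(1) = 0`. [folklore] -/
theorem zetaScrewPrimeSum_zero : zetaScrewPrimeSum 0 = 0 := by
  simp [zetaScrewPrimeSum]

/-- `Ψ(0) = 0` (Suzuki2023 p. 2: "`Ψ(0) = 0` by `Φ(1,2,1/4) = ζ(2,1/4) = C`"). [cite: Suzuki2023, p. 2] -/
theorem zetaScrew_zero : zetaScrew 0 = 0 := by
  rw [zetaScrew_eq, zetaScrewPrimeSum_zero, hurwitzLerchQuarter_zero]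
  norm_num

/-- For `|t| < log 2` no prime power contributes: `φ(t) = 0` ("there is no contribution from the
primes for `Ψ(t)` on `[0, log 2)`", Suzuki2023 proof of Thm 4.1). [cite: Suzuki2023, proof of Thm 4.1] -/
theorem zetaScrewPrimeSum_eq_zero_of_abs_lt_log_two {t : ℝ} (ht : |t| < Real.log 2) :
    zetaScrewPrimeSum t = 0 := by
  have hfloor : ⌊Real.exp |t|⌋₊ = 1 := by
    rw [Nat.floor_eq_iff (Real.exp_pos _).le]
    refine ⟨by exact_mod_cast Real.one_le_exp (abs_nonneg t), ?_⟩
    have h2 : Real.exp |t| < 2 := by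
      calc Real.exp |t| < Real.exp (Real.log 2) := Real.exp_lt_exp.2 ht
        _ = 2 := Real.exp_log two_pos
    simpa [one_add_one_eq_two] using h2
  simp [zetaScrewPrimeSum, hfloor]

/-- On the "archimedean wall" `|t| < log 2`, `Ψ` is prime-free:
`Ψ(t) = 4(e^{|t|/2} + e^{-|t|/2} - 2) - (|t|/2)(γ₀ + π/2 + 3 log 2 + log π) + (1/4)(C - e^{-|t|/2} Φ(e^{-2|t|},2,1/4))`
(Suzuki2023 proof of Thm 4.1). [cite: Suzuki2023, proof of Thm 4.1] -/
theorem zetaScrew_eq_of_abs_lt_log_two {t : ℝ} (ht : |t| < Real.log 2) :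
    zetaScrew t = 4 * (Real.exp (|t| / 2) + Real.exp (-(|t| / 2)) - 2)
      - |t| / 2 * (Real.eulerMascheroniConstant + Real.pi / 2 + 3 * Real.log 2 + Real.log Real.pi)
      + (1 / 4) * ((∑' k : ℕ, 1 / ((k : ℝ) + 1 / 4) ^ 2)
          - Real.exp (-(|t| / 2)) * hurwitzLerchQuarter t) := by
  rw [zetaScrew_eq, zetaScrewPrimeSum_eq_zero_of_abs_lt_log_two ht, sub_zero]

/-! ## Convergence and continuity -/

/-- `∑_{k ≥ 0} (k + 1/4)^{-2}` converges (a shifted `p`-series, `p = 2`). [folklore] -/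
theorem summable_one_div_nat_add_quarter_sq :
    Summable fun k : ℕ ↦ 1 / ((k : ℝ) + 1 / 4) ^ 2 := by
  have h := (Real.summable_one_div_nat_add_rpow (1 / 4) 2).2 one_lt_two
  refine h.congr fun k ↦ ?_
  rw [abs_of_pos (by positivity), Real.rpow_two]

/-- Termwise bound `|e^{-2|t|k} (k + 1/4)^{-2}| ≤ (k + 1/4)^{-2}`. [folklore] -/
theorem norm_hurwitzLerchQuarter_term_le (t : ℝ) (k : ℕ) :
    ‖Real.exp (-(2 * |t| * k)) / ((k : ℝ) + 1 / 4) ^ 2‖ ≤ 1 / ((k : ℝ) + 1 / 4) ^ 2 := by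
  rw [Real.norm_eq_abs, abs_of_nonneg (by positivity)]
  gcongr
  rw [Real.exp_le_one_iff, neg_nonpos]
  positivity

/-- The Hurwitz–Lerch series `∑ e^{-2|t|k}(k + 1/4)^{-2}` converges for every real `t`
(dominated by `∑ (k + 1/4)^{-2}`), so `hurwitzLerchQuarter t` is a genuine sum. [folklore] -/
theorem summable_hurwitzLerchQuarter (t : ℝ) :
    Summable fun k : ℕ ↦ Real.exp (-(2 * |t| * k)) / ((k : ℝ) + 1 / 4) ^ 2 :=
  summable_one_div_nat_add_quarter_sq.of_norm_bounded (norm_hurwitzLerchQuarter_term_le t)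

/-- `0 ≤ Φ(e^{-2|t|}, 2, 1/4) ≤ C`. [folklore] -/
theorem hurwitzLerchQuarter_le (t : ℝ) :
    hurwitzLerchQuarter t ≤ ∑' k : ℕ, 1 / ((k : ℝ) + 1 / 4) ^ 2 := by
  refine (summable_hurwitzLerchQuarter t).tsum_le_tsum (fun k ↦ ?_)
    summable_one_div_nat_add_quarter_sq
  have h := norm_hurwitzLerchQuarter_term_le t k
  rwa [Real.norm_eq_abs, abs_of_nonneg (by positivity)] at h

/-- `0 ≤ Φ(e^{-2|t|}, 2, 1/4)`. [folklore] -/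
theorem hurwitzLerchQuarter_nonneg (t : ℝ) : 0 ≤ hurwitzLerchQuarter t :=
  tsum_nonneg fun k ↦ by positivity

/-- `t ↦ Φ(e^{-2|t|}, 2, 1/4)` is continuous on `ℝ` (uniformly convergent series of continuous
functions). [folklore] -/
theorem continuous_hurwitzLerchQuarter : Continuous hurwitzLerchQuarter :=
  continuous_tsum
    (fun _ ↦ ((Real.continuous_exp.comp
      ((continuous_const.mul continuous_abs).mul continuous_const).neg).div_const _))
    summable_one_div_nat_add_quarter_sq (fun k t ↦ norm_hurwitzLerchQuarter_term_le t k)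

/-- Truncation of the prime sum with the positive part: if `e^{|t|} ≤ M` then
`φ(t) = ∑_{1 ≤ n ≤ M} Λ(n) n^{-1/2} max(|t| - log n, 0)` (the summands with `n > e^{|t|}`
vanish and those with `n ≤ e^{|t|}` have `log n ≤ |t|`). [folklore] -/
theorem zetaScrewPrimeSum_eq_sum_max {t : ℝ} {M : ℕ} (hM : Real.exp |t| ≤ M) :
    zetaScrewPrimeSum t = ∑ n ∈ Finset.Icc 1 M,
      ArithmeticFunction.vonMangoldt n / Real.sqrt n * max (|t| - Real.log n) 0 := by
  have hsub : Finset.Icc 1 ⌊Real.exp |t|⌋₊ ⊆ Finset.Icc 1 M :=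
    Finset.Icc_subset_Icc_right ((Nat.floor_mono hM).trans_eq (Nat.floor_natCast M))
  unfold zetaScrewPrimeSum
  calc ∑ n ∈ Finset.Icc 1 ⌊Real.exp |t|⌋₊,
        ArithmeticFunction.vonMangoldt n / Real.sqrt n * (|t| - Real.log n)
      = ∑ n ∈ Finset.Icc 1 ⌊Real.exp |t|⌋₊,
          ArithmeticFunction.vonMangoldt n / Real.sqrt n * max (|t| - Real.log n) 0 := by
        refine Finset.sum_congr rfl fun n hn ↦ ?_
        rw [Finset.mem_Icc] at hn
        have hn0 : (0 : ℝ) < n := by exact_mod_cast hn.1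
        have hle : Real.log n ≤ |t| := by
          rw [Real.log_le_iff_le_exp hn0]
          exact (Nat.le_floor_iff (Real.exp_pos _).le).1 hn.2
        rw [max_eq_left (sub_nonneg.2 hle)]
    _ = ∑ n ∈ Finset.Icc 1 M,
          ArithmeticFunction.vonMangoldt n / Real.sqrt n * max (|t| - Real.log n) 0 := by
        refine Finset.sum_subset hsub fun n hnM hnN ↦ ?_
        rw [Finset.mem_Icc] at hnM
        have hlt : ⌊Real.exp |t|⌋₊ < n := not_le.1 fun h ↦ hnN (Finset.mem_Icc.2 ⟨hnM.1, h⟩)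
        have hn0 : (0 : ℝ) < n := by exact_mod_cast hnM.1
        have hgt : |t| < Real.log n := by
          rw [Real.lt_log_iff_exp_lt hn0]
          exact (Nat.floor_lt (Real.exp_pos _).le).1 hlt
        rw [max_eq_right (sub_nonpos.2 hgt.le), mul_zero]

/-- The prime sum `φ` is continuous on `ℝ` (locally it is a finite sum of the continuous
functions `max(|t| - log n, 0)`; in particular it is continuous across the jumps of `⌊e^{|t|}⌋`,
each new summand entering with the value `0`). [folklore] -/
theorem continuous_zetaScrewPrimeSum : Continuous zetaScrewPrimeSum := by
  refine continuous_iff_continuousAt.2 fun t₀ ↦ ?_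
  set M : ℕ := ⌈Real.exp (|t₀| + 1)⌉₊ with hM
  have hcont : Continuous fun t : ℝ ↦ ∑ n ∈ Finset.Icc 1 M,
      ArithmeticFunction.vonMangoldt n / Real.sqrt n * max (|t| - Real.log n) 0 :=
    continuous_finsetSum _ fun n _ ↦
      continuous_const.mul ((continuous_abs.sub continuous_const).max continuous_const)
  refine hcont.continuousAt.congr ?_
  have hopen : IsOpen {t : ℝ | |t| < |t₀| + 1} := isOpen_lt continuous_abs continuous_const
  filter_upwards [hopen.mem_nhds (show |t₀| < |t₀| + 1 by linarith)] with t ht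
  refine (zetaScrewPrimeSum_eq_sum_max ?_).symm
  exact (Real.exp_le_exp.2 (le_of_lt ht)).trans (Nat.le_ceil _)

/-- `Ψ` is continuous on `ℝ` ("Formula (1.1) shows that `Ψ(t)` is real-valued and continuous",
Suzuki2023 p. 2). [cite: Suzuki2023, p. 2] -/
theorem continuous_zetaScrew : Continuous zetaScrew := by
  have h1 : Continuous fun t : ℝ ↦ 4 * (Real.exp (|t| / 2) + Real.exp (-(|t| / 2)) - 2) :=
    continuous_const.mul (((Real.continuous_exp.comp (continuous_abs.div_const _)).add
      (Real.continuous_exp.comp (continuous_abs.div_const _).neg)).sub continuous_const)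
  have h2 : Continuous fun t : ℝ ↦
      |t| / 2 * (Real.eulerMascheroniConstant + Real.pi / 2 + 3 * Real.log 2 + Real.log Real.pi) :=
    (continuous_abs.div_const _).mul continuous_const
  have h3 : Continuous fun t : ℝ ↦ (1 / 4 : ℝ) * ((∑' k : ℕ, 1 / ((k : ℝ) + 1 / 4) ^ 2)
      - Real.exp (-(|t| / 2)) * hurwitzLerchQuarter t) :=
    continuous_const.mul (continuous_const.sub
      ((Real.continuous_exp.comp (continuous_abs.div_const _).neg).mul
        continuous_hurwitzLerchQuarter))
  exact ((h1.sub continuous_zetaScrewPrimeSum).sub h2).add h3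

/-! ## The kernel `G_g` for `g = -Ψ` -/

/-- Suzuki's kernel (1.4), `G_g(t, u) = g(t - u) - g(t) - g(-u) + g(0)`, for the screw function
`g = -Ψ` of `ζ`: since `Ψ` is even and `Ψ(0) = 0` it equals `Ψ(t) + Ψ(u) - Ψ(t - u)`, which we
take as the definition. Under RH it is `∑_γ (e^{iγt} - 1)(e^{-iγu} - 1)/γ²` (Suzuki2023 (1.9)).
[cite: Suzuki2023, (1.4) with g = -Ψ] -/
def zetaScrewKernel (t u : ℝ) : ℝ :=
  zetaScrew t + zetaScrew u - zetaScrew (t - u)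

/-- Unfolding lemma for the kernel (by `rfl`; matches the inline `Ψ (t i) + Ψ (t j) - Ψ (t i - t j)`
of the route theses). [cite: Suzuki2023, (1.4)] -/
theorem zetaScrewKernel_def (t u : ℝ) :
    zetaScrewKernel t u = zetaScrew t + zetaScrew u - zetaScrew (t - u) :=
  rfl

/-- `G_g(t, u) = g(t - u) - g(t) - g(-u) + g(0)` literally, for `g = -Ψ`. [cite: Suzuki2023, (1.4)] -/
theorem zetaScrewKernel_eq_krein (t u : ℝ) :
    zetaScrewKernel t u =
      -zetaScrew (t - u) - (-zetaScrew t) - (-zetaScrew (-u)) + (-zetaScrew 0) := by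
  rw [zetaScrewKernel, zetaScrew_neg, zetaScrew_zero]
  ring

/-- The kernel is symmetric (because `Ψ` is even). [folklore] -/
theorem zetaScrewKernel_comm (t u : ℝ) : zetaScrewKernel t u = zetaScrewKernel u t := by
  rw [zetaScrewKernel, zetaScrewKernel, ← zetaScrew_neg (t - u), neg_sub]
  ring

/-- `G(0, u) = 0`. [folklore] -/
@[simp] theorem zetaScrewKernel_zero_left (u : ℝ) : zetaScrewKernel 0 u = 0 := by
  simp [zetaScrewKernel, zetaScrew_zero]

/-- `G(t, 0) = 0`. [folklore] -/
@[simp] theorem zetaScrewKernel_zero_right (t : ℝ) : zetaScrewKernel t 0 = 0 := by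
  simp [zetaScrewKernel, zetaScrew_zero]

/-- On the diagonal `G(t, t) = 2Ψ(t)` (Suzuki2023 p. 4: `G_g(t,t) = 2(g(0) - g(t)) = 2Ψ(t)`). [cite: Suzuki2023, p. 4] -/
theorem zetaScrewKernel_self (t : ℝ) : zetaScrewKernel t t = 2 * zetaScrew t := by
  simp only [zetaScrewKernel, sub_self, zetaScrew_zero, sub_zero, two_mul]

/-- Real symmetric kernels: for `K` real symmetric and complex coefficients `c`,
`∑ᵢⱼ conj(cᵢ) cⱼ K(i,j) = Q(Re c) + Q(Im c)` with `Q(x) = ∑ᵢⱼ K(i,j) xᵢ xⱼ`; in particular the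
complex form is real and it is non-negative for all `c ∈ ℂⁿ` iff `Q ≥ 0` on `ℝⁿ`. [folklore] -/
theorem sum_sum_conj_mul_mul_ofReal {ι : Type*} (s : Finset ι) (K : ι → ι → ℝ)
    (hK : ∀ i j, K i j = K j i) (c : ι → ℂ) :
    ∑ i ∈ s, ∑ j ∈ s, conj (c i) * c j * (K i j : ℂ) =
      ((∑ i ∈ s, ∑ j ∈ s, K i j * ((c i).re * (c j).re)
        + ∑ i ∈ s, ∑ j ∈ s, K i j * ((c i).im * (c j).im) : ℝ) : ℂ) := by
  apply Complex.ext
  · simp only [Complex.re_sum, Complex.ofReal_re]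
    rw [← Finset.sum_add_distrib]
    refine Finset.sum_congr rfl fun i _ ↦ ?_
    rw [← Finset.sum_add_distrib]
    refine Finset.sum_congr rfl fun j _ ↦ ?_
    simp only [Complex.mul_re, Complex.mul_im, Complex.conj_re, Complex.conj_im,
      Complex.ofReal_re, Complex.ofReal_im]
    ring
  · simp only [Complex.im_sum, Complex.ofReal_im]
    have h : ∀ i j, (conj (c i) * c j * (K i j : ℂ)).im
        = K i j * ((c i).re * (c j).im) - K i j * ((c i).im * (c j).re) := by
      intro i j
      simp only [Complex.mul_re, Complex.mul_im, Complex.conj_re, Complex.conj_im,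
        Complex.ofReal_re, Complex.ofReal_im]
      ring
    simp_rw [h, Finset.sum_sub_distrib]
    rw [sub_eq_zero, Finset.sum_comm]
    exact Finset.sum_congr rfl fun j _ ↦ Finset.sum_congr rfl fun i _ ↦ by rw [hK]; ring

/-- **Bridge between Suzuki's (1.5) and the route's real quadratic forms.** The kernel
`G(t,u) = Ψ(t) + Ψ(u) - Ψ(t - u)` is non-negative definite on `S` in the sense of Suzuki2023 (1.5)
(complex coefficients; the tree's `IsPosSemidefKernelOn`) iff
`∑ᵢ ∑ⱼ G(tᵢ, tⱼ) xᵢ xⱼ ≥ 0` for all finite real configurations `tᵢ ∈ S`, `xᵢ ∈ ℝ`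
(the kernel is real and symmetric). [folklore] -/
theorem isPosSemidefKernelOn_zetaScrewKernel_iff (S : Set ℝ) :
    IsPosSemidefKernelOn (fun t u : ℝ ↦ (zetaScrewKernel t u : ℂ)) S ↔
      ∀ (N : ℕ) (t x : Fin N → ℝ), (∀ i, t i ∈ S) →
        0 ≤ ∑ i, ∑ j, zetaScrewKernel (t i) (t j) * (x i * x j) := by
  constructor
  · intro h N t x ht
    have h1 : 0 ≤ ∑ i, ∑ j, conj (x i : ℂ) * (x j : ℂ) * (zetaScrewKernel (t i) (t j) : ℂ) :=
      h N t ht (fun i ↦ (x i : ℂ))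
    have h2 : ∑ i, ∑ j, conj (x i : ℂ) * (x j : ℂ) * (zetaScrewKernel (t i) (t j) : ℂ)
        = ((∑ i, ∑ j, zetaScrewKernel (t i) (t j) * (x i * x j) : ℝ) : ℂ) := by
      push_cast
      refine Finset.sum_congr rfl fun i _ ↦ Finset.sum_congr rfl fun j _ ↦ ?_
      rw [Complex.conj_ofReal]
      ring
    rw [h2, Complex.zero_le_real] at h1
    exact h1
  · intro h N t ht c
    show 0 ≤ ∑ i, ∑ j, conj (c i) * c j * (zetaScrewKernel (t i) (t j) : ℂ)
    rw [sum_sum_conj_mul_mul_ofReal Finset.univ (fun i j ↦ zetaScrewKernel (t i) (t j))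
      (fun i j ↦ zetaScrewKernel_comm _ _) c, Complex.zero_le_real]
    exact add_nonneg (h N t (fun i ↦ (c i).re) ht) (h N t (fun i ↦ (c i).im) ht)

/-- If the real quadratic forms of the kernel are non-negative on configurations in `S`, then
`Ψ ≥ 0` on `S` (the one-point configuration: `0 ≤ G(t,t) = 2Ψ(t)`; Suzuki2023 p. 4 and §4.3). [cite: Suzuki2023, §4.3] -/
theorem zetaScrew_nonneg_of_sum_nonneg {S : Set ℝ}
    (h : ∀ (N : ℕ) (t x : Fin N → ℝ), (∀ i, t i ∈ S) →
      0 ≤ ∑ i, ∑ j, zetaScrewKernel (t i) (t j) * (x i * x j))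
    {t : ℝ} (ht : t ∈ S) : 0 ≤ zetaScrew t := by
  have h1 := h 1 (fun _ ↦ t) (fun _ ↦ 1) (fun _ ↦ ht)
  simp only [Finset.univ_unique, Fin.default_eq_zero, Finset.sum_singleton, mul_one,
    zetaScrewKernel_self] at h1
  linarith

/-! ## Named facts from Suzuki (2023)

Statements as printed (hypotheses complete); `ξ = riemannXi`, zeros with multiplicity via
`ZetaZeros.riemannZetaNontrivialZeros` and `riemannZetaZeroOrder` (module docstring, "Dictionary"). -/

/-- **Suzuki2023 Thm 1.1 (1)** (one-sided Fourier transform). For `Im z > 1/2`,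
`∫₀^∞ Ψ(t) e^{izt} dt = -z^{-2} (ξ'/ξ)(1/2 - iz)`, the integral converging absolutely
(by Thm 1.1 (3), `|e^{izt}| = e^{-(Im z)t}`); here `ξ` is Riemann's `ξ` (`riemannXi`) and
`(ξ'/ξ)(1/2 - iz)` is `ξ'(s)/ξ(s)` at `s = 1/2 - iz` (`Re s > 1`, where `ξ ≠ 0`). [cite: Suzuki2023, Thm 1.1 (1)] -/
def Suzuki2023_thm11_fourier : Prop :=
  ∀ z : ℂ, 1 / 2 < z.im →
    MeasureTheory.IntegrableOn
        (fun t : ℝ ↦ (zetaScrew t : ℂ) * Complex.exp (Complex.I * z * t)) (Set.Ioi 0) ∧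
      ∫ t in Set.Ioi (0 : ℝ), (zetaScrew t : ℂ) * Complex.exp (Complex.I * z * t) =
        -(1 / z ^ 2) * (deriv riemannXi (1 / 2 - Complex.I * z) / riemannXi (1 / 2 - Complex.I * z))

/-- **Suzuki2023 Thm 1.1 (2)** (series over the zeros). For every real `t`,
`Ψ(t) = ∑_γ (1 - cos(γt))/γ²`, the sum over the zeros `γ` of `ξ(1/2 - iz)` with multiplicity,
absolutely convergent. In the variable `ρ = 1/2 - iγ` (non-trivial zeros of `ζ`, multiplicity
`m(ρ) = riemannZetaZeroOrder ρ`) the summand is `(cosh((ρ - 1/2)t) - 1)/(ρ - 1/2)²`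
(module docstring); printed for `t ≥ 0` and extended evenly, both sides being even in `t`.
(`ρ = 1/2` is not a zero of `ζ`, so no summand is a junk `0/0`.) [cite: Suzuki2023, Thm 1.1 (2)] -/
def Suzuki2023_thm11_series : Prop :=
  ∀ t : ℝ, HasSum (fun ρ : ZetaZeros.riemannZetaNontrivialZeros ↦
      (riemannZetaZeroOrder (ρ : ℂ) : ℂ) *
        ((Complex.cosh (((ρ : ℂ) - 1 / 2) * t) - 1) / ((ρ : ℂ) - 1 / 2) ^ 2))
    (zetaScrew t : ℂ)

/-- **Suzuki2023 Thm 1.1 (3)** (growth). `Ψ(t) ≪ exp(t/2 - c√t)` for some constant `c > 0`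
(for `t > 0`; from Prop. 2.1, `∑_{n ≤ e^t} Λ(n) n^{-1/2}(t - log n) = 4e^{t/2} + O(e^{t/2 - c√t})`,
and (1.1)). [cite: Suzuki2023, Thm 1.1 (3)] -/
def Suzuki2023_thm11_growth : Prop :=
  ∃ c : ℝ, 0 < c ∧ ∃ M : ℝ, ∀ t : ℝ, 0 < t →
    |zetaScrew t| ≤ M * Real.exp (t / 2 - c * Real.sqrt t)

/-- **Suzuki2023 Thm 1.2** (RH as a screw-function condition). The Riemann hypothesis holds iff
`g = -Ψ` is a screw function on `ℝ`, i.e. `g ∈ 𝒢_∞`: the kernel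
`G_g(t,u) = Ψ(t) + Ψ(u) - Ψ(t - u)` is non-negative definite on `ℝ` in the sense (1.5),
`∑ᵢⱼ G_g(tᵢ,tⱼ) ξᵢ conj(ξⱼ) ≥ 0` for all `n`, `tᵢ ∈ ℝ`, `ξᵢ ∈ ℂ` (the continuity and hermitian
symmetry required of members of `𝒢_∞` hold unconditionally for this `g`: `continuous_zetaScrew`,
`zetaScrew_neg`). Proof in the source: Lagarias' criterion `i(ξ'/ξ)(1/2 - iz) ∈ 𝒩 ⟺ RH` and the
Kreĭn–Langer correspondence `𝒢_∞ ↔ 𝒩`, via Thm 1.1 (1). The route-shaped real form is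
`Suzuki2023_thm12.iff_real`. [cite: Suzuki2023, Thm 1.2] -/
def Suzuki2023_thm12 : Prop :=
  RiemannHypothesis ↔ IsPosSemidefKernelOn (fun t u : ℝ ↦ (zetaScrewKernel t u : ℂ)) Set.univ

/-- Thm 1.2 in the real quadratic-form shape used by route PluckedString (`StringThesis`):
RH iff `∑ᵢ ∑ⱼ (Ψ(tᵢ) + Ψ(tⱼ) - Ψ(tᵢ - tⱼ)) xᵢ xⱼ ≥ 0` for all finite real configurations. [cite: Suzuki2023, Thm 1.2] -/
theorem Suzuki2023_thm12.iff_real (h : Suzuki2023_thm12) :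
    RiemannHypothesis ↔
      ∀ (N : ℕ) (t x : Fin N → ℝ), 0 ≤ ∑ i, ∑ j, zetaScrewKernel (t i) (t j) * (x i * x j) := by
  have h' : RiemannHypothesis ↔
      IsPosSemidefKernelOn (fun t u : ℝ ↦ (zetaScrewKernel t u : ℂ)) Set.univ := h
  rw [h', isPosSemidefKernelOn_zetaScrewKernel_iff]
  simp only [Set.mem_univ, implies_true, forall_const]

/-- **Suzuki2023 Thm 1.7** (pointwise positivity). RH holds iff `Ψ(t) ≥ 0` for every real `t`;
further, if RH holds then `Ψ(t) > 0` for `t ≠ 0` (sufficiency via Thm 1.1 (1) and the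
Landau–Widder theorem on Laplace transforms of non-negative functions). [cite: Suzuki2023, Thm 1.7] -/
def Suzuki2023_thm17 : Prop :=
  (RiemannHypothesis ↔ ∀ t : ℝ, 0 ≤ zetaScrew t) ∧
    (RiemannHypothesis → ∀ t : ℝ, t ≠ 0 → 0 < zetaScrew t)

/-- **Suzuki2023 Thm 4.1** (unconditional positivity near `0`). There exists `t₀ > log 2` such
that `Ψ(t) > 0` for `0 < t < t₀`. (Proof in the source: on `[0, log 2)` no prime contributes,
`Ψ'` is explicit with exactly two zeros `t₁ = 0.152631…`, `t₂ = 0.464002…`, `Ψ(0) = 0`,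
`Ψ(t₂) = 0.0396618… > 0`; see the module docstring for the constant `c` in `Ψ'`.) [cite: Suzuki2023, Thm 4.1] -/
def Suzuki2023_thm41 : Prop :=
  ∃ t₀ : ℝ, Real.log 2 < t₀ ∧ ∀ t : ℝ, 0 < t → t < t₀ → 0 < zetaScrew t

/-- **Suzuki2023 Thm 4.2** (unconditional local screw property; the "in particular" clause).
There exists `a₀ > 0` such that for every `0 < a < a₀` the restriction `g|_{[-2a,2a]}` of
`g = -Ψ` belongs to Kreĭn's class `𝒢_a`, i.e. the kernel `G_g` is non-negative definite on
`(-a, a)` in the sense (1.5). (The theorem's first clause — positive definiteness of the integral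
operator `𝖦_g[a]` on `L²(-a, a)` — is not vendored here.) [cite: Suzuki2023, Thm 4.2] -/
def Suzuki2023_thm42_screw : Prop :=
  ∃ a₀ : ℝ, 0 < a₀ ∧ ∀ a : ℝ, 0 < a → a < a₀ →
    IsPosSemidefKernelOn (fun t u : ℝ ↦ (zetaScrewKernel t u : ℂ)) (Set.Ioo (-a) a)

/-- Corollary of Thm 1.2 and the one-point configuration: if RH holds then `Ψ ≥ 0` on `ℝ`
(the easy half of Thm 1.7, derived here from the fact `Suzuki2023_thm12`). [cite: Suzuki2023, Thm 1.7 (necessity)] -/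
theorem Suzuki2023_thm12.zetaScrew_nonneg (h : Suzuki2023_thm12) (hRH : RiemannHypothesis)
    (t : ℝ) : 0 ≤ zetaScrew t :=
  zetaScrew_nonneg_of_sum_nonneg ((isPosSemidefKernelOn_zetaScrewKernel_iff _).1 (h.1 hRH))
    (Set.mem_univ t)

end Literature.NumberTheory.LFunctions
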